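import Summits.QuantumFields.YangMills.Theorems.LuscherReductionDressedRitzLiftPositionDirichlet
import Summits.QuantumFields.YangMills.Theorems.LuscherReductionDressedRitzPolyakovLiftDressed
import HarnessLib

/-!
# Crux `DressedRitz` (stmt-QuantumFields-20205), line «polyakovlift» r3–r5 — support I read on the DRESSED family: the Dirichlet identity for
# `u' = K_β^[L] u` through its insertion `O' = u'/φ`

Support module (LEAD prover ym-lead-20205-polyakovlift g0; `--supports stmt-QuantumFields-20205`, helper).  Support I (`LiftPos.dirichlet_identity`,
p526280) is stated for `ins φ O`; the registered family since r3 is the dressed lift `dressedLiftVec β φ g = K_β^[L](ins φ (flowLiftAt 0 t g))`, which IS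
`ins φ O'` for the physical `O' := dressedLiftVec β φ g / φ` (`PolyakovLift.ins_div_dressedLiftVec`, `isPhys_div_rawVacuum`, p529179).  Hence:

★ `dirichlet_identity_dressed` — `λ₀‖u'‖² − ⟨u', K_β u'⟩ = ½∬(O'(U) − O'(V))² φ(U)K_β(U,V)φ(V)` with `O' = u'/φ`: the one-step effective-mass deficit of
the DRESSED channel is the two-slice quadratic variation of the `L`-step PREDICTION `O' = K_β^[L](Ĝφ)/φ` of the flowed observable (Doob picture:
`O'/λ₀^L` is the conditional expectation of `Ĝ` `L` steps ahead under the vacuum chain) — the (o5)/(A5) currency of S-UNIV′ (r5) on the fine side.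

HONEST FRAMING: fixed-lattice bookkeeping; stubs open; nothing here bears on infinite volume, the continuum limit or the Clay gap.
References: M. Lüscher, U. Wolff, NPB 339 (1990) 222 [cite: LuscherWolff1990].
-/

set_option autoImplicit false

noncomputable section

open MeasureTheory Filter Topology Real
open Literature.MathematicalPhysics.QuantumFieldTheory (GaugeConfig Site gaugeTransform)
open scoped BigOperators

namespace Summit.QuantumFields.YangMills.Theorems.FemtoTransferGap.LiftPos

open Summit.QuantumFields.YangMills.Theorems.FemtoTransferGap
open Summit.QuantumFields.YangMills.Theorems.FemtoTransferGap.PolyakovLift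

/-- ★ **Dirichlet identity for the DRESSED lift**: with `u' = dressedLiftVec β φ g` and `O' = u'/φ` (physical), for a raw vacuum `φ` and physical `g`:
`λ₀‖u'‖² − ⟨u', K_βu'⟩ = ½∬(O'(U) − O'(V))² φ(U)K_β(U,V)φ(V)`. [cite: LuscherWolff1990] -/
theorem dirichlet_identity_dressed {L : ℕ} [NeZero L] (β : ℝ) {φ : GaugeConfig 3 L SU2 → ℝ} (hvac : IsRawVacuum β φ)
    {g : GaugeConfig 3 1 SU2 → ℝ} (hg : IsPhys g) :
    levelValue su2Rep L β 0 * l2 (dressedLiftVec β φ g) (dressedLiftVec β φ g) -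
        l2 (dressedLiftVec β φ g) (transferApply β (dressedLiftVec β φ g)) =
      (1 / 2 : ℝ) * ∫ U, ∫ V, (dressedLiftVec β φ g U / φ U - dressedLiftVec β φ g V / φ V) ^ 2 *
        (φ U * transferKernel su2Rep β U V * φ V) ∂(configMeasure SU2 L) ∂(configMeasure SU2 L) := by
  have hO' : IsPhys (fun U => dressedLiftVec β φ g U / φ U) := isPhys_div_rawVacuum β hvac (isPhys_dressedLiftVec β hvac.1 hg)
  have h := dirichlet_identity β hvac.1 hO' hvac.2.1 hvac.2.2
  rw [ins_div_dressedLiftVec β hvac hg] at h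
  exact h

end Summit.QuantumFields.YangMills.Theorems.FemtoTransferGap.LiftPos

end
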